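import Summits.HodgeConjecture.HodgeConjecture.Theorems.R90S2RecognitionOfRecordDefs      -- ★ (β) p862318: `kTypeSupport`, `RecognitionJInfOfRecordStmt`, `RecognitionDsInfOfRecordStmt`, `RecognitionDsClsOfRecordStmt` (+ `_iff`)
import Summits.HodgeConjecture.HodgeConjecture.Theorems.K2E1bModelOfRecordCohUnitary       -- ★ 8b-αᵤ road: `exists_datum`, `hwLines_of_isCohUnitaryIrrep`, `exists_lieEquiv_of_datum`, prelims `exists_mem_hwSpace_ne_zero`, `six_dvd_of_labels`, `exists_mk_eq_mk_ofRecord`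
import Summits.HodgeConjecture.HodgeConjecture.Theorems.K2E1bRecordIrreducible             -- ★ 8b-α′ `U8.recordIrreducible : RecordIrreducibleStmt`
import Summits.HodgeConjecture.HodgeConjecture.Theorems.K2E1bDatumUnitaryDual              -- ★ 8b-β `mem_iff_and_products_eq_of_vertex_of_casimir` (+ ★ `casimirScalar_eq_of_hasChiScalars`, ★ `SU21VertexRigidity`, ★ `forall_reach_of_isIrreducible`, ★ `HasChiScalars.of_mk_eq_mk`)
import Summits.HodgeConjecture.HodgeConjecture.Theorems.K2E1bDSRecordRecognition           -- ★ 8b-γ `areGKEquivalent_ofRecord_of_products_eq`, `dsCellDatum_squareComplete` (+ ★ `dsCellRep`, `dsClsOfRecord_of_regular`, `dsCellDatum_isIrreducible`)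
import HarnessLib

/-!
# R90-TF ∕ S2 «Ch11-arch» — (β) PAID: THE THREE RECOGNITION STATEMENTS OF RECORD ARE THEOREMS
# (`recognitionJInfOfRecordStmt_holds`, `recognitionDsInfOfRecordStmt_holds`, `recognitionDsClsOfRecordStmt_holds`)

Cell `hodgecm-mathlib`, programme R90-TF, section S2 (dealer K2E1b-plan (g7), DEAL «S2-β-PAY-1» 2026-09-04T22:13:43Z, twins «β-PAY-2∕3» batched in this ONE file
because they are the same proof with other carriers — D-0064); pen K2E3-p23 (g7) (`--kind proof --supports stmt-HodgeConjecture-24833 --as helper`); crux H413 =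
`stmt-HodgeConjecture-24833` (supports-only, closes nothing).  THEOREMS ONLY (no `def`, no `sorry`, no instance declaration, no local-instance attribute — every
`(𝔤, K)`-structure is mentioned through a bundled ★ `GKIrrep G21` or a ★ constant of record —, no notation).

## The statements (★ `R90S2RecognitionOfRecordDefs`, token for token)

`RecognitionJInfOfRecordStmt` ∕ `RecognitionDsInfOfRecordStmt` ∕ `RecognitionDsClsOfRecordStmt`: an irreducible coh-unitary `(𝔲(2,1), K)`-module `r`
(★ `IsCohUnitaryIrrep`) with the χ-scalars of record (★ `HasChiScalars r.ρ𝔤 κ e`) and EXACTLY the `K`-type support (★ `kTypeSupport r.ρ𝔤 e = 𝒟.S`) of the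
`J`-datum ∕ square-integrable datum ∕ record cell has the class of record ★ `jInfOfRecord p q t` ∕ ★ `dsInfOfRecord p q t` ∕ ★ `dsClsOfRecord a b c j`.

## The proof — ONE generic recognition theorem `mk_eq_mk_ofRecord_of_kTypeSupport_eq` (§2), three one-line instances (§3)

For `r` as above and ANY strongly connected Kovačević datum `𝒟′` with level-one Casimir scalar `κ − e²∕3` and square-complete `K`-type set (all three hold for an
irreducible datum whose structure of record has the χ-scalars `(κ, e)`), `kTypeSupport r.ρ𝔤 e = 𝒟′.S` forces `GKIrrClass.mk r = GKIrrClass.mk ⟨𝒟′.V, ρKOfRecord 𝒟′ e,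
σOfRecord 𝒟′ e, _, _⟩`:
1. ★ 8b-αᵤ road run OPEN (not as the black box `modelOfRecordCohUnitary`, whose `∃ 𝒟` forgets the support): ★ `hwLines_of_isCohUnitaryIrrep` feeds ★ `exists_datum`
   ⇒ a datum `𝒟` of `r` with Kovačević's normal-form family `u` and the clauses (i) `u n m ≠ 0 ⇒` labelled highest line, (ii) `(n, m) ∈ 𝒟.S ↔ u n m ≠ 0`,
   (iii) every highest vector of central label `e` is a multiple of `u`; ★ `exists_lieEquiv_of_datum` + ★ `exists_mk_eq_mk_ofRecord` ⇒
   `mk r = mk ⟨𝒟.V, ρKOfRecord 𝒟 e, σOfRecord 𝒟 e, _, _⟩`.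
2. THE SUPPORT IS THE DATUM'S `S` (`kTypeSupport_eq_of_datum`, from (i)–(iii) alone) ⇒ `𝒟.S = 𝒟′.S`.
3. `𝒟` is `𝔤𝔩₃`-irreducible (★ 8b-α′ `recordIrreducible`) hence strongly connected (★ `forall_reach_of_isIrreducible`; for `𝒟′` this is a hypothesis); a local
   minimum `x₀` of the common `S` (★ `exists_isLocalMin`) is a vertex of both, below which nothing lies, so every other `K`-type has a live lower edge
   (★ `exists_lower_of_ne`); the χ-scalars (moved onto `σOfRecord 𝒟 e` by ★ `HasChiScalars.of_mk_eq_mk`) give the level-one Casimir scalar `κ − e²∕3` on both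
   (★ `casimirScalar_eq_of_hasChiScalars`; for `𝒟′` a hypothesis); UNIQUE CONTINUATION FROM THE VERTEX ★ `mem_iff_and_products_eq_of_vertex_of_casimir` ⇒ equal invariant products
   `A D′`, `B C′`.
4. ★ 8b-γ `areGKEquivalent_ofRecord_of_products_eq` (same `S`, same products, square-complete) ⇒ the structures of record are `(𝔤, K)`-equivalent ⇒ equal classes
   (★ `GKIrrClass.mk_eq_mk_iff`).
Instances: `𝒟′ = jDatumOfRecord (p + t)` ∕ `dsDatumOfRecord (p + t)` (ladder ∕ wall RAYS: square-completeness is vacuous, `jDatumOfRecord_squareComplete`,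
`dsDatumOfRecord_squareComplete`; strong connectivity from irreducibility ★ `jDatumOfRecord_spec` ∕ `dsDatumOfRecord_spec` via ★ `forall_reach_of_isIrreducible`;
level-one Casimir via ★ `casimirScalar_eq_of_hasChiScalars` on ★ `jRepOfRecord_package` ∕ `dsRepOfRecord_package`) and `𝒟′ = dsCellDatum j a b c` at a regular
parameter (★ `dsCellDatum_reach`, ★ `dsCellDatum_isIrreducible` + ★ `dsCellRep_package`, ★ `dsCellDatum_squareComplete`, ★ `dsClsOfRecord_of_regular`).  No new
vertex computation, no ray-specific `K`-type bookkeeping beyond the two-line square-completeness.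

Sources: [Kovacevic2021] §3 Def. 1, Thm. 1–3, Remark 3; §4 Thm. 4–5; [Rogawski1990] §12.3 pp. 176–178; [BorelWallach2000] 0 §2.5, I §4.3, VI 4.10–4.12;
[KnappVogan1995] §I.4, §II.4.  HONEST LABEL: recognition lemmas identify OUR carriers of record, they attribute nothing to print's `J^±_φ`, `D_φ` (label R-H3,
hole D-S2-5); HC_CM is proved only modulo the 7 printed citations (2 remaining named inputs: hLiu418 = `stmt-HodgeConjecture-24832`, h413 =
`stmt-HodgeConjecture-24833`) until rung 0 closes; count-neutral.
-/

set_option autoImplicit false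
-- the mandated namespace repeats the single-problem summit's segment (`HodgeConjecture.HodgeConjecture`)
set_option linter.dupNamespace false

noncomputable section

open Module
open Literature.NumberTheory.Automorphic
open Literature.RepresentationTheory Literature.RepresentationTheory.BorelWallach2000
open Literature.RepresentationTheory.KonnoKonno2007 Literature.RepresentationTheory.KonnoKonno2007.RealDualPair
open Literature.RepresentationTheory.KonnoKonno2007.RealDualPair.UForm
open Literature.RepresentationTheory.Kovacevic2021 Literature.RepresentationTheory.Kovacevic2021.SU21Datum
open Summit.HodgeConjecture.HodgeConjecture.Cruxes.H413.F0P3bLocalAPacketsDefs (G21)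
open Summit.HodgeConjecture.HodgeConjecture.Cruxes.H413.F0P3bArchDegOnePackage (IsCohUnitaryIrrep)
open Summit.HodgeConjecture.HodgeConjecture.Cruxes.H413.K2E1bGKCohomologyU21
open Summit.HodgeConjecture.HodgeConjecture.Cruxes.H413.K2E1bGKCohomologyU21.U8
open Summit.HodgeConjecture.HodgeConjecture.Cruxes.H413.K2E1bU21Weights
open Summit.HodgeConjecture.HodgeConjecture.Cruxes.H413.K2E1bU21DatumRelations
open Summit.HodgeConjecture.HodgeConjecture.Cruxes.H413.K2E1bU21HwLines
open Summit.HodgeConjecture.HodgeConjecture.Cruxes.H413.K2E1bModelOfRecord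
open Summit.HodgeConjecture.HodgeConjecture.Cruxes.H413.K2E1bU21ModelEquiv
open Summit.HodgeConjecture.HodgeConjecture.Cruxes.H413.K2E1bCarriersOfRecord
open Summit.HodgeConjecture.HodgeConjecture.Cruxes.H413.K2E1bDatumCubicScalar
open Summit.HodgeConjecture.HodgeConjecture.Cruxes.H413.K2E1bDatumUnitaryDual
open Summit.HodgeConjecture.HodgeConjecture.Cruxes.H413.K2E1bDSCellData
open Summit.HodgeConjecture.HodgeConjecture.Cruxes.H413.K2E1bDSClsOfRecord
open Summit.HodgeConjecture.HodgeConjecture.Cruxes.H413.K2E1bDSRecordRecognition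

namespace Summit.HodgeConjecture.HodgeConjecture.R90.S2

/-! ## §1 Square-completeness of the data of record on the strips (vacuous on a ray) [Kovacevic2021, §3 Remark 3; §4] -/

/-- **The `K`-type set of the `J`-datum of record is square-complete** — vacuously: on a ladder RAY `m = ±(3n + e′)`, so `(n, m − 3)` and `(n, m + 3)` are never
both `K`-types. [cite: Kovacevic2021, §3 Remark 3; §4 Thm. 4–5] [cite: Rogawski1990, §12.3 p. 178] -/
theorem jDatumOfRecord_squareComplete (s n m : ℤ) (h1 : (n, m - 3) ∈ (jDatumOfRecord s).S) (h2 : (n, m + 3) ∈ (jDatumOfRecord s).S)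
    (_h3 : (n + 1, m) ∈ (jDatumOfRecord s).S) : (n - 1, m) ∈ (jDatumOfRecord s).S := by
  exfalso
  by_cases hs : s ≤ -1
  · rw [jDatumOfRecord_of_le hs] at h1 h2
    obtain ⟨-, h1⟩ := h1
    obtain ⟨-, h2⟩ := h2
    dsimp only at h1 h2
    omega
  · rw [jDatumOfRecord_of_not_le hs] at h1 h2
    obtain ⟨-, h1⟩ := h1
    obtain ⟨-, h2⟩ := h2
    dsimp only at h1 h2
    omega

/-- **The `K`-type set of the square-integrable datum of record is square-complete** — vacuously (wall RAY). [cite: Kovacevic2021, §4 Thm. 4–5]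
[cite: Rogawski1990, §12.3 pp. 177–178] -/
theorem dsDatumOfRecord_squareComplete (s n m : ℤ) (h1 : (n, m - 3) ∈ (dsDatumOfRecord s).S) (h2 : (n, m + 3) ∈ (dsDatumOfRecord s).S)
    (_h3 : (n + 1, m) ∈ (dsDatumOfRecord s).S) : (n - 1, m) ∈ (dsDatumOfRecord s).S := by
  exfalso
  by_cases hs : s ≤ -1
  · rw [dsDatumOfRecord_of_le hs] at h1 h2
    obtain ⟨-, h1⟩ := h1
    obtain ⟨-, h2⟩ := h2
    dsimp only at h1 h2
    omega
  · rw [dsDatumOfRecord_of_not_le hs] at h1 h2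
    obtain ⟨-, h1⟩ := h1
    obtain ⟨-, h2⟩ := h2
    dsimp only at h1 h2
    omega

/-! ## §2 The generic recognition theorem [Kovacevic2021, §3 Thm. 1–3, Remark 3; Rogawski1990, §12.3 pp. 176–178] -/

/-- **THE `K`-TYPE SUPPORT IS THE DATUM'S `S`.**  For a Kovačević datum `𝒟` of a bundled irreducible `(𝔤, K)`-module `r` with normal-form family `u` in the three clauses of ★ `exists_datum`
— (i) `u n m ≠ 0 ⇒ u n m` is a `𝔨`-highest vector of labels `(n, m, e)`, (ii) `(n, m) ∈ 𝒟.S ↔ u n m ≠ 0`, (iii) every `𝔨`-highest vector of central label `e` is a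
multiple of the `u` with its labels — the `K`-type support ★ `kTypeSupport ρ𝔤 e` IS `𝒟.S`. [cite: Kovacevic2021, §3 Def. 1, Thm. 1] [cite: BorelWallach2000, 0 §2.5] -/
theorem kTypeSupport_eq_of_datum (r : GKIrrep G21) (e : ℤ) (𝒟 : SU21Datum)
    (u : ℤ → ℤ → r.V) (hi : ∀ n m : ℤ, u n m ≠ 0 → ∃ w, labelN w = n ∧ labelM w = m ∧ labelE w = e ∧ u n m ∈ hwSpace r.ρ𝔤 w)
    (hii : ∀ n m : ℤ, (n, m) ∈ 𝒟.S ↔ u n m ≠ 0)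
    (hiii : ∀ (w : Fin 2 ⊕ Fin 1 → ℤ) (y : r.V), labelE w = e → y ∈ hwSpace r.ρ𝔤 w → ∃ c : ℂ, y = c • u (labelN w) (labelM w)) :
    kTypeSupport r.ρ𝔤 e = 𝒟.S := by
  ext ⟨n, m⟩
  rw [mem_kTypeSupport_iff, hii]
  constructor
  · rintro ⟨w, hN, hM, hE, hbot⟩
    obtain ⟨y, hy, hy0⟩ := (Submodule.ne_bot_iff _).1 hbot
    obtain ⟨c, hc⟩ := hiii w y hE hy
    rw [hN, hM] at hc
    intro h0
    exact hy0 (by rw [hc, h0, smul_zero])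
  · intro h0
    obtain ⟨w, hN, hM, hE, hw⟩ := hi n m h0
    exact ⟨w, hN, hM, hE, (Submodule.ne_bot_iff _).2 ⟨u n m, hw, h0⟩⟩

/-- **GENERIC RECOGNITION ⇒ CLASS EQUALITY.**  Let `r` be an irreducible coh-unitary `(𝔲(2,1), K)`-module (★ `IsCohUnitaryIrrep`) with χ-scalars `(κ, e)`
(★ `HasChiScalars`), and let `𝒟′` be a strongly connected Kovačević datum (★ `forall_reach_of_isIrreducible` for an irreducible one) with level-one Casimir
scalar `κ − e²∕3` (★ `casimirScalar_eq_of_hasChiScalars` when `σOfRecord 𝒟′ e` has the χ-scalars `(κ, e)`; vacuous if `𝒟′` has no level-one `K`-type) and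
square-complete `K`-type set.  If `r` has EXACTLY the `K`-type support `𝒟′.S`, then `GKIrrClass.mk r` is the class of the structure of record of `𝒟′` (for ANY
proofs of its `(𝔤, K)`-axioms and irreducibility).  Proof: module docstring, steps 1–4.  (Hypotheses on `𝒟′` are spelled combinatorially — `Reach`, `casimirScalar`
— so that no `LieRing (Matrix …)` instance has to be named: this file declares no local instance.) [cite: Kovacevic2021, §3 Thm. 1–3, Remark 3]
[cite: Rogawski1990, §12.3 pp. 176–178] [cite: BorelWallach2000, 0 §2.5; I §4.3] [cite: KnappVogan1995, §I.4 (1.64)–(1.65), §II.4] -/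
theorem mk_eq_mk_ofRecord_of_kTypeSupport_eq (r : GKIrrep G21) {κ e : ℤ} (hr : IsCohUnitaryIrrep r.ρK r.ρ𝔤) (hχ : HasChiScalars r.ρ𝔤 κ e)
    {𝒟' : SU21Datum} (hconn' : ∀ x ∈ 𝒟'.S, ∀ y ∈ 𝒟'.S, 𝒟'.Reach x y)
    (hcas' : ∀ m : ℤ, ((1 : ℤ), m) ∈ 𝒟'.S → 𝒟'.casimirScalar 1 m = (κ : ℂ) - (e : ℂ) ^ 2 / 3)
    (hsq' : ∀ n m : ℤ, (n, m - 3) ∈ 𝒟'.S → (n, m + 3) ∈ 𝒟'.S → (n + 1, m) ∈ 𝒟'.S → (n - 1, m) ∈ 𝒟'.S)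
    (hsupp : kTypeSupport r.ρ𝔤 e = 𝒟'.S)
    (hGK' : IsGKModule G21 (ρKOfRecord 𝒟' e) (σOfRecord 𝒟' e)) (hirrGK' : IsIrreducibleGK (ρKOfRecord 𝒟' e) (σOfRecord 𝒟' e)) :
    GKIrrClass.mk r = GKIrrClass.mk ⟨𝒟'.V, ρKOfRecord 𝒟' e, σOfRecord 𝒟' e, hGK', hirrGK'⟩ := by
  have hV : IsGKModule G21 r.ρK r.ρ𝔤 := r.isGKModule
  haveI : Nontrivial r.V := r.isIrreducible.nontrivial
  -- STEP 1: the datum of `r` (★ 8b-αᵤ road run open) and the class of its structure of record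
  have he : ∀ (w : Fin 2 ⊕ Fin 1 → ℤ) (v : r.V), v ∈ wtSpace r.ρ𝔤 w → v ≠ 0 → labelE w = e :=
    fun w v hv hv0 => labelE_eq_of_center r.ρ𝔤 hv hv0 hχ.2
  obtain ⟨𝒟, u, hi, hii, hiii, hiv, hv⟩ := exists_datum r.ρ𝔤 hV e (hwLines_of_isCohUnitaryIrrep r hr)
  obtain ⟨w, g, hg, hg0, hwe⟩ := exists_mem_hwSpace_ne_zero hV e he
  obtain ⟨c, hc⟩ := hiii w g hwe hg
  have hne : ∃ n m : ℤ, u n m ≠ 0 := ⟨labelN w, labelM w, fun h0 => hg0 (by rw [hc, h0, smul_zero])⟩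
  have hdiv : ∀ n m : ℤ, (n, m) ∈ 𝒟.S → (6 : ℤ) ∣ m - 3 * n + 3 + 2 * e := by
    intro n m hnm
    obtain ⟨w', hN, hM, hE, -⟩ := hi n m ((hii n m).mp hnm)
    exact six_dvd_of_labels hN hM hE
  obtain ⟨Φ, hΦ⟩ := exists_lieEquiv_of_datum r.ρ𝔤 hV r.isIrreducible hi hii hiv hv hne
  obtain ⟨hGK, hirrGK, hmk⟩ := exists_mk_eq_mk_ofRecord r e 𝒟 hdiv Φ hΦ
  -- STEP 2: the support of `r` is `𝒟.S`, hence `𝒟.S = 𝒟′.S`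
  have hS : 𝒟.S = 𝒟'.S := (kTypeSupport_eq_of_datum r e 𝒟 u hi hii hiii).symm.trans hsupp
  -- STEP 3: strong connectivity, the common vertex, live lower edges, level-one Casimir scalars ⇒ equal products
  have hdirr := recordIrreducible 𝒟 e hGK hirrGK
  have hconn : ∀ x ∈ 𝒟.S, ∀ y ∈ 𝒟.S, 𝒟.Reach x y := forall_reach_of_isIrreducible (hirr := hdirr)
  obtain ⟨n₀, m₀, hu₀⟩ := hne
  have hSne : 𝒟'.S.Nonempty := ⟨(n₀, m₀), by rw [← hS]; exact (hii n₀ m₀).2 hu₀⟩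
  obtain ⟨x₀, h₀', h₀D', h₀C', -⟩ := exists_isLocalMin hSne
  have h₀ : x₀ ∈ 𝒟.S := by rw [hS]; exact h₀'
  have h₀D : (x₀.1 - 1, x₀.2 - 3) ∉ 𝒟.S := by rw [hS]; exact h₀D'
  have h₀C : (x₀.1 - 1, x₀.2 + 3) ∉ 𝒟.S := by rw [hS]; exact h₀C'
  have hχ𝒟 : HasChiScalars (σOfRecord 𝒟 e) κ e := hχ.of_mk_eq_mk hmk
  have key := fun n m => mem_iff_and_products_eq_of_vertex_of_casimir h₀ h₀'
    (fun n m hy hy₀ => exists_lower_of_ne hconn h₀ h₀D h₀C hy hy₀)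
    (fun n m hy hy₀ => exists_lower_of_ne hconn' h₀' h₀D' h₀C' hy hy₀)
    (fun m hm => casimirScalar_eq_of_hasChiScalars 𝒟 hdirr hχ𝒟 hm) hcas' n m
  -- STEP 4: same `S`, same products, square-complete ⇒ `(𝔤, K)`-equivalent structures of record ⇒ equal classes
  rw [hmk, GKIrrClass.mk_eq_mk_iff]
  exact areGKEquivalent_ofRecord_of_products_eq hS hconn hconn' h₀ h₀D h₀C
    (fun n m h1 h2 h3 => by rw [hS] at h1 h2 h3 ⊢; exact hsq' n m h1 h2 h3)
    (fun n m => (key n m).2.1) (fun n m => (key n m).2.2) e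

/-! ## §3 The three recognition statements of record, PAID [Rogawski1990, §12.3 pp. 176–178; Kovacevic2021, §3 Thm. 2–3, Remark 3; §4 Thm. 4–5] -/

/-- **(β) PAY-1 — RECOGNITION OF `jInfOfRecord` (every `(p, q, t)`)**: `RecognitionJInfOfRecordStmt` holds — §2 at `𝒟′ = jDatumOfRecord (p + t)`,
`e = centralExp p q t`, `κ = casimirExp p q t` (★ `jDatumOfRecord_spec` irreducibility ⇒ ★ `forall_reach_of_isIrreducible`; ★ `jRepOfRecord_package` χ-scalars ⇒
★ `casimirScalar_eq_of_hasChiScalars`; `jDatumOfRecord_squareComplete`;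
the class of record ★ `jInfOfRecord p q t = GKIrrClass.mk (jRepOfRecord p q t)` by definition). [cite: Rogawski1990, §12.3 p. 178]
[cite: Kovacevic2021, §3 Thm. 2–3, Remark 3; §4 Thm. 4–5] -/
theorem recognitionJInfOfRecordStmt_holds : RecognitionJInfOfRecordStmt := by
  intro p q t r hr hχ hsupp
  show GKIrrClass.mk r = GKIrrClass.mk (jRepOfRecord p q t)
  exact mk_eq_mk_ofRecord_of_kTypeSupport_eq r hr hχ (𝒟' := jDatumOfRecord (p + t))
    (forall_reach_of_isIrreducible (hirr := (jDatumOfRecord_spec p q t _ _ _ rfl).1))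
    (fun m hm => casimirScalar_eq_of_hasChiScalars (jDatumOfRecord (p + t)) (jDatumOfRecord_spec p q t _ _ _ rfl).1 (jRepOfRecord_package p q t).2 hm)
    (jDatumOfRecord_squareComplete (p + t)) hsupp (jRepOfRecord p q t).isGKModule (jRepOfRecord p q t).isIrreducible

/-- **(β) PAY-2 — RECOGNITION OF `dsInfOfRecord` (every `(p, q, t)`)**: `RecognitionDsInfOfRecordStmt` holds — §2 at `𝒟′ = dsDatumOfRecord (p + t)` (wall ray;
★ `dsDatumOfRecord_spec`, ★ `dsRepOfRecord_package`, `dsDatumOfRecord_squareComplete`; ★ `dsInfOfRecord p q t = GKIrrClass.mk (dsRepOfRecord p q t)`).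
[cite: Rogawski1990, §12.3 pp. 177–178] [cite: Kovacevic2021, §3 Thm. 2–3, Remark 3; §4 Thm. 4–5] [cite: BorelWallach2000, VI 4.10] -/
theorem recognitionDsInfOfRecordStmt_holds : RecognitionDsInfOfRecordStmt := by
  intro p q t r hr hχ hsupp
  show GKIrrClass.mk r = GKIrrClass.mk (dsRepOfRecord p q t)
  exact mk_eq_mk_ofRecord_of_kTypeSupport_eq r hr hχ (𝒟' := dsDatumOfRecord (p + t))
    (forall_reach_of_isIrreducible (hirr := (dsDatumOfRecord_spec p q t _ _ _ rfl).1))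
    (fun m hm => casimirScalar_eq_of_hasChiScalars (dsDatumOfRecord (p + t)) (dsDatumOfRecord_spec p q t _ _ _ rfl).1 (dsRepOfRecord_package p q t).2 hm)
    (dsDatumOfRecord_squareComplete (p + t)) hsupp (dsRepOfRecord p q t).isGKModule (dsRepOfRecord p q t).isIrreducible

/-- **(β) PAY-3 — RECOGNITION OF `dsClsOfRecord` (cells; regular `(a, b, c)`, `j : Fin 3`)**: `RecognitionDsClsOfRecordStmt` holds — §2 at
`𝒟′ = dsCellDatum j a b c`, `e = centralOf a b c`, `κ = casimirOf a b c` (★ `dsCellDatum_isIrreducible`, ★ `dsCellRep_package`, ★ `dsCellDatum_squareComplete`;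
★ `dsClsOfRecord_of_regular : dsClsOfRecord a b c j = GKIrrClass.mk (dsCellRep a b c j h)`).  The abstract-module form of ★ `mk_ofRecord_eq_dsClsOfRecord`.
[cite: Rogawski1990, §12.3 pp. 176–178] [cite: Kovacevic2021, §3 Thm. 2–3, Remark 3] [cite: BorelWallach2000, VI 4.10–4.12] -/
theorem recognitionDsClsOfRecordStmt_holds : RecognitionDsClsOfRecordStmt := by
  intro a b c habc j r hr hχ hsupp
  rw [dsClsOfRecord_of_regular habc j]
  exact mk_eq_mk_ofRecord_of_kTypeSupport_eq r hr hχ (𝒟' := dsCellDatum j a b c) (dsCellDatum_reach habc j)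
    (fun m hm => casimirScalar_eq_of_hasChiScalars (dsCellDatum j a b c) (dsCellDatum_isIrreducible habc j) (dsCellRep_package habc j).2 hm)
    (dsCellDatum_squareComplete habc j) hsupp (dsCellRep a b c j habc).isGKModule (dsCellRep a b c j habc).isIrreducible

end Summit.HodgeConjecture.HodgeConjecture.R90.S2

end
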